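/-
Copyright (c) 2026 the pub-hodgecm-mathlib formalisation cell (harness21).  Prover seat hodgecm-mathlib-K2Liu-p03 (g9), Track B «K2-LIT» ∕ hLiu418 #184♮ =
`stmt-HodgeConjecture-24832`, socket #41 KIND 1, block K1-b♮ (dec-2-pay) F3 (`hFx′` road, near∕far ENTRY letters): «THE COSET REPRESENTATIVES `w_Δ n(ι_v b·δ)` (`|b| ≤ 1`)
AND `w_Δ n(ι_v b′·δ) w_Δ` (`|b′| ≤ C`) OF THE RANK-ONE LOCAL INTERTWINING INTEGRAL HAVE ENTRIES OF BOUNDED NORM — BOUND `1` AT A PLACE WHERE `2` AND `δ` ARE UNITS».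
THEOREMS ONLY (no `def`, no `instance`, no notation, no named-fact hypothesis, no `sorry`); lane `--supports stmt-HodgeConjecture-24832 --as helper`.
-/
import Summits.HodgeConjecture.HodgeConjecture.Theorems.K2LiuUnipDeltaRankOneHaar           -- ★ `continuous_nElem_coord` (+ ★ rank-one coordinates `skew_coord`, `isIntegralAt_coord_iff`)
import Summits.HodgeConjecture.HodgeConjecture.Theorems.K2LiuSiegelWeylUnipotentIwasawa      -- ★ `weylDelta_mul_nElem_mem_localInt`, `weylDelta_mul_nElem_mul_weylDelta_mem_localInt`
import Summits.HodgeConjecture.HodgeConjecture.Theorems.K2LiuSiegelCocycleLetters            -- ★ `norm_eq_coe_normAbs`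
import Literature.NumberTheory.Automorphic.ValuedFieldValuativeRelBridge                    -- ★ `mem_glInt_iff_forall_v_le_one`
import Literature.NumberTheory.Automorphic.TateLocalZetaShells                              -- ★ `isCompact_primePowBall`, `IsNonarchimedeanLocalField.isCompact_closedBall`
import HarnessLib

/-!
# Crux `HLiu418`, socket #41, KIND 1 b♮ (dec-2-pay) F3 — `K2LiuLocalWeylUnipotentEntrySize`: ENTRY LETTERS OF THE RANK-ONE COSET REPRESENTATIVES

Cell `hodgecm-mathlib`, crux item hLiu418 = `stmt-HodgeConjecture-24832` (helper lane, count-neutral).  Namespace `…Cruxes.HLiu418.K2LiuLocalWeylUnipotentEntrySize`.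
WHY.  ★ F3-loc `K2LiuKindOneLineLocalAbsoluteMajorant` §2 bounds the line's local integral `∫_{N_Δ(F_v)} ψ(u) f(w_Δ u x) dν(u)` from two VALUE letters at the coset
representatives `u_near(b) = w_Δ·n(ι_v b·δ)` (`|b|_v ≤ 1`) and `u_far(b′) = w_Δ·n(ι_v b′·δ)·w_Δ` (`|b′|_v ≤ |d⁻¹|_v`); ★ `K2LiuKindOneLineLocalTranslateSize` §3 turns an
ENTRY letter for `u` (`the entries of u_w have norm ≤ R_u`) into those value letters.  THIS FILE pays the entry letters, in the ★ D10 generic currency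
(`H(F_v) = U(T₀ ⊕ −T₀)(F_v)`, rank one):
* §1 **at a place where `|2|_w = |δ|_w = 1` for every `w ∣ v` the bound is `1`** — `u_near(b) ∈ K_v` for `|b|_v ≤ 1` (★ `weylDelta_mul_nElem_mem_localInt`, ★
  `isIntegralAt_coord_iff`) and `u_far(b′) ∈ K_v` for `|b′|_v ≤ 1` (★ `weylDelta_mul_nElem_mul_weylDelta_mem_localInt`), and elements of `K_v = H(𝒪_v)` have entries of
  norm `≤ 1` (`norm_apply_le_one_of_mem_localInt`, ★ `mem_glInt_iff_forall_v_le_one`);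
* §2 **at every place the entries are bounded on `|b|_v ≤ C`** — `b ↦ u_near(b)`, `b ↦ u_far(b)` are continuous (★ `continuous_nElem_coord`) and `{|b|_v ≤ C}` is compact
  (★ `IsNonarchimedeanLocalField.isCompact_closedBall`), so `∃ R ≥ 1` bounding every entry above `v` (`exists_entry_bound_near`, `exists_entry_bound_far`).
References: [GelbartRogawski1991, §3.1 (3.1.3)]; [HarrisKudlaSweet1996, §6 (6.14)–(6.16)]; [Casselman1980, §3]; [BorelJacquet1979, §1.2]; [Weil1965, §37];
[BushnellHenniart2006, §1.1].
HONEST LABEL: HC_CM is proved only modulo the 7 printed citations (2 remaining named inputs: hLiu418 = stmt-HodgeConjecture-24832, h413 = stmt-HodgeConjecture-24833) until rung 0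
closes; count-neutral helper (`--supports stmt-HodgeConjecture-24832 --as helper`).
-/

set_option autoImplicit false
set_option linter.dupNamespace false -- the mandated namespace repeats `HodgeConjecture.HodgeConjecture`

noncomputable section

open NumberField IsDedekindDomain Matrix Topology
open scoped ValuativeRel NNReal
open Literature.NumberTheory.GaloisRepresentations.IsNonarchimedeanLocalField
open Literature.NumberTheory.Automorphic Literature.NumberTheory.Automorphic.UnitaryGroup
open Literature.NumberTheory.GelbartRogawski1991.AdaptedBlocks
open Literature.NumberTheory.GelbartRogawski1991.UnitaryDualPair.LocalSplitting
open Literature.NumberTheory.K2Lit.LocalSiegelDoubled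
open Summit.HodgeConjecture.HodgeConjecture.Cruxes.HLiu418.K2LiuUnipDeltaLocalCoordinates
open Summit.HodgeConjecture.HodgeConjecture.Cruxes.HLiu418.K2LiuUnipDeltaRankOneCoordinates
open Summit.HodgeConjecture.HodgeConjecture.Cruxes.HLiu418.K2LiuUnipDeltaRankOneHaar (continuous_nElem_coord)
open Summit.HodgeConjecture.HodgeConjecture.Cruxes.HLiu418.K2LiuSiegelWeylUnipotentIwasawa (weylDelta_mul_nElem_mem_localInt weylDelta_mul_nElem_mul_weylDelta_mem_localInt)

namespace Summit.HodgeConjecture.HodgeConjecture.Cruxes.HLiu418.K2LiuLocalWeylUnipotentEntrySize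

variable (F : Type) [Field F] [NumberField F] (E : Type) [Field E] [NumberField E] [Algebra F E]
  (c : E ≃ₐ[F] E) {δ : E} (hcδ : c δ = -δ) (v : HeightOneSpectrum (𝓞 F))

/-! ## §0 Entries of `K_v = H(𝒪_v)` -/

section LocalInt

variable (N : ℕ) {J : Matrix (Fin N) (Fin N) E}

/-- **entries of an element of `K_v = H(𝒪_v)` have norm `≤ 1`** at every `w ∣ v` (★ `mem_localInt_iff`, ★ `mem_glInt_iff_forall_v_le_one`; the generic twin of ★
`K2LiuKindWFiniteSectionSupBound.norm_apply_le_one_of_mem_localInt`). [cite: BorelJacquet1979, §1.2] -/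
theorem norm_apply_le_one_of_mem_localInt {k : UnitaryGroup.localPi E c N J v} (hk : k ∈ UnitaryGroup.localInt E c N J v) (w : PlacesOver E v) (a b : Fin N) :
    ‖(((k : UnitaryGroup.LocalGLPi E N v) w : GL (Fin N) (w.1.adicCompletion E)) : Matrix (Fin N) (Fin N) (w.1.adicCompletion E)) a b‖ ≤ 1 := by
  have hw := (UnitaryGroup.mem_localInt_iff E c N J v k).1 hk w
  exact Valued.toNormedField.norm_le_one_iff.2 (((mem_glInt_iff_forall_v_le_one _).1 hw).1 a b)

end LocalInt

/-! ## §1 At a place where `2` and `δ` are units: entry bound `1` -/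

section RankOne

variable {T₀ : Matrix (Fin 1) (Fin 1) F} (hT₀d : IsUnit T₀.det)
  {JD : Matrix (Fin (1 + 1)) (Fin (1 + 1)) E} (hJD : JD = (gramD F 1 T₀).map (algebraMap F E))

include hcδ hT₀d hJD in
/-- **near representatives at a good place**: if `|2|_w = |δ|_w = 1` for every `w ∣ v` and `‖b‖_v ≤ 1`, the entries of `(w_Δ · n(ι_v b·δ))_w` have norm `≤ 1` —
`n(ι_v b·δ)` has integral coordinate (★ `isIntegralAt_coord_iff`), so `w_Δ n(ι_v b·δ) ∈ K_v` (★ `weylDelta_mul_nElem_mem_localInt`), §0.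
[cite: GelbartRogawski1991, §3.1 (3.1.3)] [cite: HarrisKudlaSweet1996, §6 (6.14)–(6.16)] [cite: Casselman1980, §3] -/
theorem norm_apply_weylDelta_mul_nElem_coord_le_one
    (h2 : ∀ w : PlacesOver E v, ValuativeRel.valuation (w.1.adicCompletion E) (2 : w.1.adicCompletion E) = 1)
    (hδw : ∀ w : PlacesOver E v, Valued.v ((δ : E) : w.1.adicCompletion E) = 1) {b : v.adicCompletion F} (hb : ‖b‖ ≤ 1) (w : PlacesOver E v) (a b' : Fin (1 + 1)) :
    ‖((((weylDelta F E c v 1 hJD * nElem F E c v 1 hJD (Matrix.of fun _ _ : Fin 1 => toLocalRing E v b * algebraMap E (LocalRing E v) δ) (skew_coord F E c hcδ v hT₀d b) :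
        UnitaryGroup.localPi E c (1 + 1) JD v) : UnitaryGroup.LocalGLPi E (1 + 1) v) w : GL (Fin (1 + 1)) (w.1.adicCompletion E)) : Matrix (Fin (1 + 1)) (Fin (1 + 1)) (w.1.adicCompletion E)) a b'‖ ≤ 1 := by
  have hbv : Valued.v b ≤ 1 := Valued.toNormedField.norm_le_one_iff.1 hb
  exact norm_apply_le_one_of_mem_localInt F E c v (1 + 1)
    (weylDelta_mul_nElem_mem_localInt F E c v 1 hJD _ (skew_coord F E c hcδ v hT₀d b) h2 fun w' => (isIntegralAt_coord_iff F E v w' (hδw w') b).2 hbv) w a b'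

include hcδ hT₀d hJD in
/-- **far representatives at a good place**: if `|2|_w = |δ|_w = 1` for every `w ∣ v` and `‖b′‖_v ≤ 1`, the entries of `(w_Δ · n(ι_v b′·δ) · w_Δ)_w` have norm `≤ 1`
(★ `weylDelta_mul_nElem_mul_weylDelta_mem_localInt`, ★ `isIntegralAt_coord_iff`, §0). [cite: GelbartRogawski1991, §3.1 (3.1.3)] [cite: HarrisKudlaSweet1996, §6 (6.14)–(6.16)] -/
theorem norm_apply_weylDelta_mul_nElem_coord_mul_weylDelta_le_one
    (h2 : ∀ w : PlacesOver E v, ValuativeRel.valuation (w.1.adicCompletion E) (2 : w.1.adicCompletion E) = 1)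
    (hδw : ∀ w : PlacesOver E v, Valued.v ((δ : E) : w.1.adicCompletion E) = 1) {b : v.adicCompletion F} (hb : ‖b‖ ≤ 1) (w : PlacesOver E v) (a b' : Fin (1 + 1)) :
    ‖((((weylDelta F E c v 1 hJD * nElem F E c v 1 hJD (Matrix.of fun _ _ : Fin 1 => toLocalRing E v b * algebraMap E (LocalRing E v) δ) (skew_coord F E c hcδ v hT₀d b) *
        weylDelta F E c v 1 hJD : UnitaryGroup.localPi E c (1 + 1) JD v) : UnitaryGroup.LocalGLPi E (1 + 1) v) w : GL (Fin (1 + 1)) (w.1.adicCompletion E)) :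
        Matrix (Fin (1 + 1)) (Fin (1 + 1)) (w.1.adicCompletion E)) a b'‖ ≤ 1 := by
  have hbv : Valued.v b ≤ 1 := Valued.toNormedField.norm_le_one_iff.1 hb
  exact norm_apply_le_one_of_mem_localInt F E c v (1 + 1)
    (weylDelta_mul_nElem_mul_weylDelta_mem_localInt F E c v 1 hJD _ (skew_coord F E c hcδ v hT₀d b) h2 fun w' => (isIntegralAt_coord_iff F E v w' (hδw w') b).2 hbv) w a b'

/-! ## §2 At every place: the entries are bounded on `‖b‖_v ≤ C` (continuity and compactness) -/

include hcδ hT₀d hJD in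
/-- **continuity of the entries of the near representatives** `b ↦ ((w_Δ n(ι_v b·δ))_w)_{a b′}` (★ `continuous_nElem_coord`, left translation, evaluation at `w`, the entry map).
[cite: Weil1965, §37] -/
theorem continuous_apply_weylDelta_mul_nElem_coord (w : PlacesOver E v) (a b' : Fin (1 + 1)) :
    Continuous fun b : v.adicCompletion F =>
      ((((weylDelta F E c v 1 hJD * nElem F E c v 1 hJD (Matrix.of fun _ _ : Fin 1 => toLocalRing E v b * algebraMap E (LocalRing E v) δ) (skew_coord F E c hcδ v hT₀d b) :
        UnitaryGroup.localPi E c (1 + 1) JD v) : UnitaryGroup.LocalGLPi E (1 + 1) v) w : GL (Fin (1 + 1)) (w.1.adicCompletion E)) : Matrix (Fin (1 + 1)) (Fin (1 + 1)) (w.1.adicCompletion E)) a b' := by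
  have hn : Continuous fun b : v.adicCompletion F => (nElem F E c v 1 hJD (Matrix.of fun _ _ : Fin 1 => toLocalRing E v b * algebraMap E (LocalRing E v) δ) (skew_coord F E c hcδ v hT₀d b) :
      UnitaryGroup.localPi E c (1 + 1) JD v) := continuous_subtype_val.comp (continuous_nElem_coord F E c hcδ v hT₀d hJD)
  have hmul : Continuous fun b : v.adicCompletion F => (weylDelta F E c v 1 hJD * nElem F E c v 1 hJD (Matrix.of fun _ _ : Fin 1 => toLocalRing E v b * algebraMap E (LocalRing E v) δ) (skew_coord F E c hcδ v hT₀d b) :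
      UnitaryGroup.localPi E c (1 + 1) JD v) := continuous_const.mul hn
  have hcoe : Continuous fun b : v.adicCompletion F => (((weylDelta F E c v 1 hJD * nElem F E c v 1 hJD (Matrix.of fun _ _ : Fin 1 => toLocalRing E v b * algebraMap E (LocalRing E v) δ) (skew_coord F E c hcδ v hT₀d b) :
      UnitaryGroup.localPi E c (1 + 1) JD v) : UnitaryGroup.LocalGLPi E (1 + 1) v) w : GL (Fin (1 + 1)) (w.1.adicCompletion E)) :=
    (continuous_apply w).comp (continuous_subtype_val.comp hmul)
  exact (Units.continuous_val.comp hcoe).matrix_elem a b'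

include hcδ hT₀d hJD in
/-- **continuity of the entries of the far representatives** `b ↦ ((w_Δ n(ι_v b·δ) w_Δ)_w)_{a b′}`. [cite: Weil1965, §37] -/
theorem continuous_apply_weylDelta_mul_nElem_coord_mul_weylDelta (w : PlacesOver E v) (a b' : Fin (1 + 1)) :
    Continuous fun b : v.adicCompletion F =>
      ((((weylDelta F E c v 1 hJD * nElem F E c v 1 hJD (Matrix.of fun _ _ : Fin 1 => toLocalRing E v b * algebraMap E (LocalRing E v) δ) (skew_coord F E c hcδ v hT₀d b) *
        weylDelta F E c v 1 hJD : UnitaryGroup.localPi E c (1 + 1) JD v) : UnitaryGroup.LocalGLPi E (1 + 1) v) w : GL (Fin (1 + 1)) (w.1.adicCompletion E)) :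
        Matrix (Fin (1 + 1)) (Fin (1 + 1)) (w.1.adicCompletion E)) a b' := by
  have hn : Continuous fun b : v.adicCompletion F => (nElem F E c v 1 hJD (Matrix.of fun _ _ : Fin 1 => toLocalRing E v b * algebraMap E (LocalRing E v) δ) (skew_coord F E c hcδ v hT₀d b) :
      UnitaryGroup.localPi E c (1 + 1) JD v) := continuous_subtype_val.comp (continuous_nElem_coord F E c hcδ v hT₀d hJD)
  have hmul : Continuous fun b : v.adicCompletion F => (weylDelta F E c v 1 hJD * nElem F E c v 1 hJD (Matrix.of fun _ _ : Fin 1 => toLocalRing E v b * algebraMap E (LocalRing E v) δ) (skew_coord F E c hcδ v hT₀d b) *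
      weylDelta F E c v 1 hJD : UnitaryGroup.localPi E c (1 + 1) JD v) := (continuous_const.mul hn).mul continuous_const
  have hcoe : Continuous fun b : v.adicCompletion F => (((weylDelta F E c v 1 hJD * nElem F E c v 1 hJD (Matrix.of fun _ _ : Fin 1 => toLocalRing E v b * algebraMap E (LocalRing E v) δ) (skew_coord F E c hcδ v hT₀d b) *
      weylDelta F E c v 1 hJD : UnitaryGroup.localPi E c (1 + 1) JD v) : UnitaryGroup.LocalGLPi E (1 + 1) v) w : GL (Fin (1 + 1)) (w.1.adicCompletion E)) :=
    (continuous_apply w).comp (continuous_subtype_val.comp hmul)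
  exact (Units.continuous_val.comp hcoe).matrix_elem a b'

omit [NumberField E] [Algebra F E] in
/-- **the closed ball `{‖b‖_v ≤ ‖a‖_v}` of `F_v` is compact** (★ `IsNonarchimedeanLocalField.isCompact_closedBall`, ‖·‖ monotone in the valuation ★ `normAbs_le_normAbs_iff`,
★ `norm_eq_coe_normAbs`). [cite: BushnellHenniart2006, §1.1] -/
theorem isCompact_setOf_norm_le_norm (a : v.adicCompletion F) : IsCompact {b : v.adicCompletion F | ‖b‖ ≤ ‖a‖} := by
  have h : {b : v.adicCompletion F | ‖b‖ ≤ ‖a‖} = {b : v.adicCompletion F | ValuativeRel.valuation (v.adicCompletion F) b ≤ ValuativeRel.valuation (v.adicCompletion F) a} := by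
    ext b
    simp only [Set.mem_setOf_eq]
    rw [K2LiuSiegelCocycleLetters.norm_eq_coe_normAbs, K2LiuSiegelCocycleLetters.norm_eq_coe_normAbs, NNReal.coe_le_coe, normAbs_le_normAbs_iff]
  rw [h]
  exact IsNonarchimedeanLocalField.isCompact_closedBall (v.adicCompletion F) (ValuativeRel.valuation (v.adicCompletion F) a)

omit [NumberField E] [Algebra F E] in
/-- **a continuous real function is bounded on `{‖b‖_v ≤ ‖a‖_v}`** (compactness §2). [cite: BushnellHenniart2006, §1.1] -/
theorem exists_bound_of_continuous_of_norm_le (a : v.adicCompletion F) {φ : v.adicCompletion F → ℝ} (hφ : Continuous φ) :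
    ∃ C, ∀ b : v.adicCompletion F, ‖b‖ ≤ ‖a‖ → φ b ≤ C := by
  obtain ⟨C, hC⟩ := (isCompact_setOf_norm_le_norm F v a).exists_bound_of_continuousOn hφ.continuousOn
  exact ⟨C, fun b hb => (le_abs_self _).trans ((Real.norm_eq_abs _).symm.le.trans (hC b hb))⟩

include hcδ hT₀d hJD in
/-- **NEAR ENTRY LETTER, EVERY PLACE**: `∃ R ≥ 1` such that for all `b` with `‖b‖_v ≤ ‖a‖_v` every entry of `(w_Δ n(ι_v b·δ))_w` (`w ∣ v`) has norm `≤ R` — the finite sum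
of the entry norms is continuous (§2) and bounded on the compact ball. [cite: Weil1965, §37] [cite: BushnellHenniart2006, §1.1] [cite: BorelJacquet1979, §1.2] -/
theorem exists_entry_bound_near (a : v.adicCompletion F) :
    ∃ R : ℝ, 1 ≤ R ∧ ∀ b : v.adicCompletion F, ‖b‖ ≤ ‖a‖ → ∀ (w : PlacesOver E v) (i j : Fin (1 + 1)),
      ‖((((weylDelta F E c v 1 hJD * nElem F E c v 1 hJD (Matrix.of fun _ _ : Fin 1 => toLocalRing E v b * algebraMap E (LocalRing E v) δ) (skew_coord F E c hcδ v hT₀d b) :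
        UnitaryGroup.localPi E c (1 + 1) JD v) : UnitaryGroup.LocalGLPi E (1 + 1) v) w : GL (Fin (1 + 1)) (w.1.adicCompletion E)) : Matrix (Fin (1 + 1)) (Fin (1 + 1)) (w.1.adicCompletion E)) i j‖ ≤ R := by
  -- one bound per entry (§2 continuity + compactness), then the max over the finitely many entries
  have key : ∀ (w : PlacesOver E v) (i j : Fin (1 + 1)), ∃ C : ℝ, ∀ b : v.adicCompletion F, ‖b‖ ≤ ‖a‖ →
      ‖((((weylDelta F E c v 1 hJD * nElem F E c v 1 hJD (Matrix.of fun _ _ : Fin 1 => toLocalRing E v b * algebraMap E (LocalRing E v) δ) (skew_coord F E c hcδ v hT₀d b) :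
        UnitaryGroup.localPi E c (1 + 1) JD v) : UnitaryGroup.LocalGLPi E (1 + 1) v) w : GL (Fin (1 + 1)) (w.1.adicCompletion E)) : Matrix (Fin (1 + 1)) (Fin (1 + 1)) (w.1.adicCompletion E)) i j‖ ≤ C :=
    fun w i j => exists_bound_of_continuous_of_norm_le F v a (continuous_apply_weylDelta_mul_nElem_coord F E c hcδ v hT₀d hJD w i j).norm
  choose C hC using key
  refine ⟨max 1 (Finset.univ.sup' ⟨(Classical.arbitrary (PlacesOver E v), 0, 0), Finset.mem_univ _⟩ fun p : PlacesOver E v × Fin (1 + 1) × Fin (1 + 1) => C p.1 p.2.1 p.2.2),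
    le_max_left _ _, fun b hb w i j => (hC w i j b hb).trans ((le_max_right _ _).trans' ?_)⟩
  exact Finset.le_sup' (f := fun p : PlacesOver E v × Fin (1 + 1) × Fin (1 + 1) => C p.1 p.2.1 p.2.2) (Finset.mem_univ (w, i, j))

include hcδ hT₀d hJD in
/-- **FAR ENTRY LETTER, EVERY PLACE**: `∃ R ≥ 1` such that for all `b′` with `‖b′‖_v ≤ ‖a‖_v` every entry of `(w_Δ n(ι_v b′·δ) w_Δ)_w` (`w ∣ v`) has norm `≤ R`.
[cite: Weil1965, §37] [cite: BushnellHenniart2006, §1.1] [cite: BorelJacquet1979, §1.2] -/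
theorem exists_entry_bound_far (a : v.adicCompletion F) :
    ∃ R : ℝ, 1 ≤ R ∧ ∀ b : v.adicCompletion F, ‖b‖ ≤ ‖a‖ → ∀ (w : PlacesOver E v) (i j : Fin (1 + 1)),
      ‖((((weylDelta F E c v 1 hJD * nElem F E c v 1 hJD (Matrix.of fun _ _ : Fin 1 => toLocalRing E v b * algebraMap E (LocalRing E v) δ) (skew_coord F E c hcδ v hT₀d b) *
        weylDelta F E c v 1 hJD : UnitaryGroup.localPi E c (1 + 1) JD v) : UnitaryGroup.LocalGLPi E (1 + 1) v) w : GL (Fin (1 + 1)) (w.1.adicCompletion E)) :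
        Matrix (Fin (1 + 1)) (Fin (1 + 1)) (w.1.adicCompletion E)) i j‖ ≤ R := by
  have key : ∀ (w : PlacesOver E v) (i j : Fin (1 + 1)), ∃ C : ℝ, ∀ b : v.adicCompletion F, ‖b‖ ≤ ‖a‖ →
      ‖((((weylDelta F E c v 1 hJD * nElem F E c v 1 hJD (Matrix.of fun _ _ : Fin 1 => toLocalRing E v b * algebraMap E (LocalRing E v) δ) (skew_coord F E c hcδ v hT₀d b) *
        weylDelta F E c v 1 hJD : UnitaryGroup.localPi E c (1 + 1) JD v) : UnitaryGroup.LocalGLPi E (1 + 1) v) w : GL (Fin (1 + 1)) (w.1.adicCompletion E)) :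
        Matrix (Fin (1 + 1)) (Fin (1 + 1)) (w.1.adicCompletion E)) i j‖ ≤ C :=
    fun w i j => exists_bound_of_continuous_of_norm_le F v a (continuous_apply_weylDelta_mul_nElem_coord_mul_weylDelta F E c hcδ v hT₀d hJD w i j).norm
  choose C hC using key
  refine ⟨max 1 (Finset.univ.sup' ⟨(Classical.arbitrary (PlacesOver E v), 0, 0), Finset.mem_univ _⟩ fun p : PlacesOver E v × Fin (1 + 1) × Fin (1 + 1) => C p.1 p.2.1 p.2.2),
    le_max_left _ _, fun b hb w i j => (hC w i j b hb).trans ((le_max_right _ _).trans' ?_)⟩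
  exact Finset.le_sup' (f := fun p : PlacesOver E v × Fin (1 + 1) × Fin (1 + 1) => C p.1 p.2.1 p.2.2) (Finset.mem_univ (w, i, j))

end RankOne

end Summit.HodgeConjecture.HodgeConjecture.Cruxes.HLiu418.K2LiuLocalWeylUnipotentEntrySize

end
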